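import Summits.KontsevichZagierPeriods.KontsevichZagierPeriods.Theses.IsogenyCertificates
import Literature.NumberTheory.Transcendental.KZLogCalculusProofs
import Literature.NumberTheory.EllipticCurves.RealPeriod
import Summits.KontsevichZagierPeriods.KontsevichZagierPeriods.Theorems.EffectiveXMapChains.Negative.PeriodRep

/-!
# `AlgebraicModuliRealPeriodCell` (stmt-KontsevichZagierPeriods-18265) — negative knowledge II:
values of the generators, the one-cubic sub-cases, and the cusp

Landed copy of §2b and §4 of `Cruxes/AlgebraicModuliRealPeriodCell/Disproof.lean` (cdisprove seat); companion of
`Negative/LoadBearing.lean` (algebraicity hypotheses are decoration; `eval c = 0` is load-bearing).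

* `value_eq`, `realPeriodR_pos` — every generator `[{x³+αx+β>0}, a/√(x³+αx+β)]` of the cell (any
  representation with that domain and integrand-on-domain, `α β a` REAL) has value `a · Ω(E_{α,β})` with
  `Ω = WeierstrassCurve.realPeriod ⟨0,0,0,α,β⟩ = ∫_{P>0} dx/√P > 0` (the real-coefficient version of the
  tree's `EffectiveXMapChainsNegative.periodRep_value`, which has `A B : ℤ`).
* SMALL MODELS OF THE CRUX ARE TRUE: `single_generator_kernel` (one generator with value `0` has scalar
  `a = 0` and is a relation) and `same_cubic_kernel₂` (`[P, a/√P] − [P, b/√P]` with value `0` is a relation,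
  rule (1b)); so a counterexample to the crux needs two DISTINCT cubics, i.e. a genuine `ℚ̄`-linear relation
  between real periods of different curves.
* `no_rep_at_cusp` — what deleting `4α³ + 27β² ≠ 0` does at the cusp `P = x³` (`α = β = 0`, algebraic):
  nothing — no `KZ.IntegralRep 1` with domain `{x³ > 0}` and integrand `a/√(x³)`, `a ≠ 0`, exists
  (`a·x^{-3/2}` is not integrable at `0⁺`), so the instance is vacuous rather than false.

No statement of the tree is changed; theorems only.
-/

noncomputable section

namespace Summit.KontsevichZagierPeriods.AlgebraicModuliRealPeriodCellNegative

open Set MeasureTheory Polynomial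
open Literature.NumberTheory.Transcendental
open Summit.KontsevichZagierPeriods.IsogenyCertificates.EffectiveXMapChainsNegative (sqrt_four_mul)

/-! ## Values of the generators -/

/-- The 2-torsion polynomial of the real model `y² = x³ + αx + β` (written `WeierstrassCurve.mk 0 0 0 α β`
throughout; no abbreviation is introduced, to keep this file definition-free) is `4(x³ + αx + β)`. [folklore] -/
theorem curveR_ψ (α β t : ℝ) :
    (WeierstrassCurve.mk 0 0 0 α β : WeierstrassCurve ℝ).twoTorsionPolynomial.toPoly.eval t = 4 * (t ^ 3 + α * t + β) := by
  simp only [WeierstrassCurve.twoTorsionPolynomial, Cubic.toPoly, WeierstrassCurve.b₂,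
    WeierstrassCurve.b₄, WeierstrassCurve.b₆, eval_add, eval_mul, eval_C, eval_pow, eval_X]
  ring

/-- Its discriminant is `−16(4α³ + 27β²)`. [folklore] -/
theorem curveR_Δ (α β : ℝ) : (WeierstrassCurve.mk 0 0 0 α β : WeierstrassCurve ℝ).Δ = -16 * (4 * α ^ 3 + 27 * β ^ 2) := by
  simp only [WeierstrassCurve.Δ, WeierstrassCurve.b₂, WeierstrassCurve.b₄,
    WeierstrassCurve.b₆, WeierstrassCurve.b₈]
  ring

/-- `4α³ + 27β² ≠ 0` makes it an elliptic curve. [folklore] -/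
theorem curveR_isElliptic {α β : ℝ} (h : 4 * α ^ 3 + 27 * β ^ 2 ≠ 0) : (WeierstrassCurve.mk 0 0 0 α β : WeierstrassCurve ℝ).IsElliptic := by
  rw [WeierstrassCurve.isElliptic_iff, curveR_Δ, isUnit_iff_ne_zero]
  exact mul_ne_zero (by norm_num) h

/-- The 2-torsion set is `{x³ + αx + β > 0}`. [folklore] -/
theorem curveR_twoTorsionSet (α β : ℝ) : (WeierstrassCurve.mk 0 0 0 α β : WeierstrassCurve ℝ).twoTorsionSet = {t | 0 < t ^ 3 + α * t + β} := by
  ext t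
  rw [WeierstrassCurve.mem_twoTorsionSet_iff, curveR_ψ, mem_setOf_eq]
  exact mul_pos_iff_of_pos_left (by norm_num)

/-- `a/√P = 2a·(√ψ)⁻¹`, `ψ = 4P` (also at the junk value `√P = 0`). [folklore] -/
theorem div_sqrt_eq (a t α β : ℝ) :
    a / Real.sqrt (t ^ 3 + α * t + β) =
      2 * a * (Real.sqrt ((WeierstrassCurve.mk 0 0 0 α β : WeierstrassCurve ℝ).twoTorsionPolynomial.toPoly.eval t))⁻¹ := by
  rw [curveR_ψ, sqrt_four_mul]
  by_cases hu : Real.sqrt (t ^ 3 + α * t + β) = 0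
  · simp [hu]
  · field_simp

/-- `∫_{x ∈ ℝ¹, P(x₀)>0} a/√P(x₀) = a · Ω(E_{α,β})` (transport `ℝ¹ → ℝ`; `realPeriod = 2∫_{ψ>0} (√ψ)⁻¹`).
[cite: CremonaAlgorithms1997, §3.7] -/
theorem setIntegral_rep (α β a : ℝ) :
    ∫ x in {x : Fin 1 → ℝ | 0 < x 0 ^ 3 + α * x 0 + β}, a / Real.sqrt (x 0 ^ 3 + α * x 0 + β) =
      a * (WeierstrassCurve.mk 0 0 0 α β : WeierstrassCurve ℝ).realPeriod := by
  have he := MeasureTheory.volume_preserving_funUnique (Fin 1) ℝ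
  have h1 := he.setIntegral_preimage_emb (MeasurableEquiv.measurableEmbedding _)
    (fun t : ℝ => a / Real.sqrt (t ^ 3 + α * t + β)) {t | 0 < t ^ 3 + α * t + β}
  refine h1.trans ?_
  have hmeas : MeasurableSet {t : ℝ | 0 < t ^ 3 + α * t + β} := by
    rw [← curveR_twoTorsionSet]; exact (WeierstrassCurve.mk 0 0 0 α β : WeierstrassCurve ℝ).measurableSet_twoTorsionSet
  rw [setIntegral_congr_fun hmeas (fun t _ => div_sqrt_eq a t α β), integral_const_mul,
    WeierstrassCurve.realPeriod, curveR_twoTorsionSet]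
  ring

/-- **Value of a generator**: a representation with the cell's domain `{P > 0}` and integrand `a/√P` on it
has value `a · Ω(E_{α,β})`, `Ω = WeierstrassCurve.realPeriod ⟨0,0,0,α,β⟩`. [cite: CremonaAlgorithms1997, §3.7] -/
theorem value_eq {α β a : ℝ} {r : KZ.IntegralRep 1} (hd : r.domain = {x | 0 < x 0 ^ 3 + α * x 0 + β})
    (hi : EqOn r.integrand (fun x => a / Real.sqrt (x 0 ^ 3 + α * x 0 + β)) r.domain) :
    r.value = a * (WeierstrassCurve.mk 0 0 0 α β : WeierstrassCurve ℝ).realPeriod := by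
  unfold KZ.IntegralRep.value
  rw [setIntegral_congr_fun (KZ.IntegralRep.measurableSet_domain_holds r) hi, hd]
  exact setIntegral_rep α β a

/-- `Ω(E_{α,β}) > 0` for nonsingular real `(α, β)` (tree: `WeierstrassCurve.realPeriod_pos'`). [folklore] -/
theorem realPeriodR_pos {α β : ℝ} (h : 4 * α ^ 3 + 27 * β ^ 2 ≠ 0) : 0 < (WeierstrassCurve.mk 0 0 0 α β : WeierstrassCurve ℝ).realPeriod := by
  haveI := curveR_isElliptic h
  exact (WeierstrassCurve.mk 0 0 0 α β : WeierstrassCurve ℝ).realPeriod_pos'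

/-! ## The one-cubic sub-cases of the crux are true -/

/-- **A single generator with value `0` is a relation**: its scalar is `0` (`Ω > 0`), so its integrand
vanishes on the domain. Any counterexample to the crux therefore combines ≥ 2 generators. [folklore] -/
theorem single_generator_kernel {α β a : ℝ} (hΔ : 4 * α ^ 3 + 27 * β ^ 2 ≠ 0) (r : KZ.IntegralRep 1)
    (hd : r.domain = {x | 0 < x 0 ^ 3 + α * x 0 + β})
    (hi : EqOn r.integrand (fun x => a / Real.sqrt (x 0 ^ 3 + α * x 0 + β)) r.domain)
    (h0 : KZ.eval (KZ.of r) = 0) : KZ.of r ∈ KZ.relations := by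
  rw [KZ.eval_of, value_eq hd hi] at h0
  have ha : a = 0 := (mul_eq_zero.1 h0).resolve_right (realPeriodR_pos hΔ).ne'
  refine KZ.of_mem_relations_of_eqOn_zero r fun x hx => ?_
  rw [hi hx, ha]
  simp

/-- **Two generators on the SAME cubic with value `0` form a relation** (`aΩ = bΩ ⇒ a = b ⇒` the integrands
agree on the common domain; tree: `KZ.of_sub_of_mem_relations_of_eqOn`, rule (1b)). So a counterexample to
the crux involves two DISTINCT cubics. [folklore] -/
theorem same_cubic_kernel₂ {α β a b : ℝ} (hΔ : 4 * α ^ 3 + 27 * β ^ 2 ≠ 0) (r r' : KZ.IntegralRep 1)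
    (hd : r.domain = {x | 0 < x 0 ^ 3 + α * x 0 + β})
    (hi : EqOn r.integrand (fun x => a / Real.sqrt (x 0 ^ 3 + α * x 0 + β)) r.domain)
    (hd' : r'.domain = {x | 0 < x 0 ^ 3 + α * x 0 + β})
    (hi' : EqOn r'.integrand (fun x => b / Real.sqrt (x 0 ^ 3 + α * x 0 + β)) r'.domain)
    (h0 : KZ.eval (KZ.of r - KZ.of r') = 0) : KZ.of r - KZ.of r' ∈ KZ.relations := by
  rw [map_sub, KZ.eval_of, KZ.eval_of, value_eq hd hi, value_eq hd' hi', sub_eq_zero] at h0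
  have hab : a = b := mul_right_cancel₀ (realPeriodR_pos hΔ).ne' h0
  refine KZ.of_sub_of_mem_relations_of_eqOn (hd'.trans hd.symm) fun x hx => ?_
  have hx' : x ∈ r'.domain := by rw [hd', ← hd]; exact hx
  rw [hi hx, hi' hx', hab]

/-! ## The cusp: deleting `4α³ + 27β² ≠ 0` adds no representation there -/

/-- The coordinate image of `(0, ∞)` under `ℝ¹ ≃ ℝ`. [folklore] -/
theorem funUnique_preimage_Ioi :
    (⇑(MeasurableEquiv.funUnique (Fin 1) ℝ)) ⁻¹' Ioi 0 = {x : Fin 1 → ℝ | 0 < x 0} := by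
  ext x
  simp [MeasurableEquiv.funUnique]

/-- **No representation at the cusp.** With `α = β = 0` and `a ≠ 0` there is NO `KZ.IntegralRep 1` with
domain `{x³ > 0}` and integrand `a/√(x³)` on it: `a·x^{-3/2}` is not integrable at `0⁺`
(`intervalIntegral.integrableOn_Ioo_rpow_iff`). So the nonsingularity hypothesis excludes a VACUOUS
instance, not a false one. [folklore] -/
theorem no_rep_at_cusp {a : ℝ} (ha : a ≠ 0) (r : KZ.IntegralRep 1)
    (hd : r.domain = {x | 0 < x 0 ^ 3 + 0 * x 0 + 0})
    (hi : EqOn r.integrand (fun x => a / Real.sqrt (x 0 ^ 3 + 0 * x 0 + 0)) r.domain) : False := by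
  have hd' : r.domain = {x : Fin 1 → ℝ | 0 < x 0} := by
    rw [hd]
    ext x
    simp only [zero_mul, add_zero, mem_setOf_eq]
    exact Odd.pow_pos_iff (by decide : Odd 3)
  have hint : IntegrableOn (fun x : Fin 1 → ℝ => a / Real.sqrt (x 0 ^ 3)) {x | 0 < x 0} := by
    rw [← hd']
    refine r.integrableOn.congr_fun (fun x hx => ?_) (KZ.IntegralRep.measurableSet_domain_holds r)
    rw [hi hx]
    simp
  -- transport to `ℝ`
  have e := volume_preserving_funUnique (Fin 1) ℝ
  have h2 : IntegrableOn (fun t : ℝ => a / Real.sqrt (t ^ 3)) (Ioi 0) := by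
    refine (e.integrableOn_comp_preimage (MeasurableEquiv.measurableEmbedding _)).1 ?_
    have hcomp : ((fun t : ℝ => a / Real.sqrt (t ^ 3)) ∘ ⇑(MeasurableEquiv.funUnique (Fin 1) ℝ)) =
        fun x => a / Real.sqrt (x 0 ^ 3) := by
      funext x
      simp [MeasurableEquiv.funUnique]
    rw [funUnique_preimage_Ioi, hcomp]
    exact hint
  -- restrict to `(0,1)` and compare with `t^{-3/2}`
  have h3 : IntegrableOn (fun t : ℝ => t ^ (-(3 / 2) : ℝ)) (Ioo 0 1) := by
    have h4 : IntegrableOn (fun t : ℝ => a⁻¹ * (a / Real.sqrt (t ^ 3))) (Ioo 0 1) :=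
      (h2.mono_set Ioo_subset_Ioi_self).const_mul a⁻¹
    refine h4.congr_fun (fun t ht => ?_) measurableSet_Ioo
    have ht0 : 0 < t := ht.1
    show a⁻¹ * (a / Real.sqrt (t ^ 3)) = t ^ (-(3 / 2) : ℝ)
    rw [← mul_div_assoc, inv_mul_cancel₀ ha, Real.sqrt_eq_rpow, ← Real.rpow_natCast,
      ← Real.rpow_mul ht0.le, one_div, Real.rpow_neg ht0.le]
    norm_num
  have := (intervalIntegral.integrableOn_Ioo_rpow_iff one_pos).1 h3
  norm_num at this

end Summit.KontsevichZagierPeriods.AlgebraicModuliRealPeriodCellNegative
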